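import Mathlib
import Literature.Computability.Complexity.BoolEncodings
import Literature.Computability.Complexity.PolyHierarchy
import Literature.Computability.Complexity.CountingHierarchy
import HarnessLib

/-!
# `PosSLP`: the sign of an integer given by a straight-line program (Allender–Bürgisser–Kjeldgaard-Pedersen–Miltersen 2009)

The decision problem **PosSLP** of E. Allender, P. Bürgisser, J. Kjeldgaard-Pedersen and
P. B. Miltersen, *On the complexity of numerical analysis*, SIAM J. Comput. 38 (2009) 1987–2006
(conference version CCC 2006), §2: "PosSLP: Given a straight-line program representing `N ∈ ℤ`,
decide whether `N > 0`", where a (division-free, input-free) straight-line program is "a sequence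
of instructions corresponding to a sequential evaluation of an arithmetic circuit" with the
constant `1` and the operations `+, −, ×` (§2, first paragraph), together with the paper's main
upper bound, vendored as a NAMED FACT:

* `slpStep`, `slpValue` — the evaluation of a flattened program: the value list starts `[1]`;
  an instruction `(op, j, k)` appends `v_j ∘ v_k` with `∘ = +, −, ×` for `op % 3 = 0, 1, 2`;
  out-of-range operands read `0`; the value of the program is the last entry (`1` for the empty
  program). This is *verbatim* the encoding fixed by the route
  `Summits/PneNP/PneNP/Theses/StraightLineSign.lean` (planner, 2026-08-17), which is polynomially
  equivalent to ABKM's (constants `0, 1`: `0 = 1 − 1` costs one instruction; the code length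
  changes by a logarithmic factor through the list-of-naturals encoding).
* `posSLP : Language Bool` — the language of `encodingListNatBool`-codes of flattened programs
  `[op₁, j₁, k₁, op₂, j₂, k₂, …]` with positive value. By construction
  `Summit.PneNP.PneNP.Theses.StraightLineSign.PosSLPInPH` is *definitionally* `posSLP ∈ PH` and
  `….PosSLPNotInP` is `posSLP ∉ Classes.P` (checked by `Iff.rfl` in the grounder's scratch file;
  Literature cannot import Summits, so the bridge is not restated here).
* `AllenderEtAl2009_posSLP_mem_CH` — **ABKM Theorem 1.4 in its counting-hierarchy form**:
  `posSLP ∈ CH` (printed: Thm 1.4 "PosSLP is in `P^{PP^{PP^{PP}}}`"; §3 heading "PosSLP lies in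
  CH"; Thm 3.1 "BitSLP is in CH" with "Theorem 3.1 shows that BitSLP and PosSLP both lie in CH",
  §3 p. 13; Thm 3.2 `PosSLP ∈ PH^{PP^{PP}}`). We vendor the CH form, which the tree can state with
  Wagner's `CH = ⋃ₖ CₖP` of `Literature.Computability.Complexity.CountingHierarchy`; the exact
  level `P^{PP^{PP^{PP}}} ⊆ C₄P` would need the relativised towers `PRel`/`PPRelClass` composed
  three deep and is deliberately NOT restated (it is recorded in this docstring only).

What this grounds. The route crux `PosSLPInPH` (`posSLP ∈ PH`) is STRONGER than the vendored
fact (`PH ⊆ CH`, `Literature.Computability.Complexity.PH_subset_CH_holds`); ABKM leave "better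
upper bounds for PosSLP" as a "major open problem" (§1.3, after Thm 1.4), so the fact is context
and a consistency check (e.g. `PP = P → posSLP ∈ P` via `CH_eq_P_of_PP_eq_P`), not a proof of
the crux. The companion crux `PosSLPNotInP` has no printed theorem at all ("providing any sort of
hardness theorem" is the second open problem of §1.3).

Deliberately not here: BitSLP/DegSLP/EquSLP/ACIT and the reduction chain
`EquSLP ≤ ACIT ≤ DegSLP ≤ PosSLP ≤ BitSLP` (Props 2.2–2.3), `#P`-hardness of BitSLP (Prop 2.4),
the Blum–Shub–Smale reading `P^PosSLP = BP(P⁰_ℝ)` (Prop 1.1; no real machines in tree), the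
conditional NP-hardness of Bürgisser–Jindal (SODA 2024, Thm 1.2; needs the constructive radical
conjecture as an open `def`), and Jindal–Saranurak's `τ₊`-mechanism (arXiv:1212.2549, Fact 2).

## References

* E. Allender, P. Bürgisser, J. Kjeldgaard-Pedersen, P. B. Miltersen, *On the complexity of
  numerical analysis*, SIAM J. Comput. 38(5) (2009) 1987–2006, doi:10.1137/070697926; §2
  (definitions), Thm 1.4, §3 (Thms 3.1, 3.2). Bib key `AllenderEtAl2009`.
* K. W. Wagner, Acta Inform. 23 (1986) 325–356; J. Torán, J. ACM 38 (1991) 753–774 (`CH`).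
-/

namespace Literature.Computability.AlgebraicComplexity

open Literature.Computability.Complexity

/-- One step of a flattened division-free straight-line program over `{1; +, −, ×}` acting on the
list of values computed so far: instruction `(op, j, k)` appends `v_j + v_k`, `v_j − v_k` or
`v_j * v_k` according to `op % 3 = 0, 1, 2`, where `v_i` is the `i`-th computed value and
out-of-range indices read `0` (ABKM 2009, §2: "a sequence of instructions corresponding to a
sequential evaluation of an arithmetic circuit"; this total encoding is the route
`StraightLineSign`'s, polynomially equivalent to the printed one). [cite: AllenderEtAl2009, §2 (straight-line programs)] -/
def slpStep (vs : List ℤ) (ins : ℕ × ℕ × ℕ) : List ℤ :=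
  vs ++ [if ins.1 % 3 = 0 then vs.getD ins.2.1 0 + vs.getD ins.2.2 0
    else if ins.1 % 3 = 1 then vs.getD ins.2.1 0 - vs.getD ins.2.2 0
    else vs.getD ins.2.1 0 * vs.getD ins.2.2 0]

/-- The integer represented by a flattened straight-line program: fold `slpStep` from the initial
value list `[1]` (the constant `1`) and return the last computed value (junk `1` is never reached:
the folded list is nonempty). (ABKM 2009, §2: "division-free straight-line programs using no
indeterminates, which thus represent an integer".) [cite: AllenderEtAl2009, §2 (straight-line programs representing an integer)] -/
def slpValue (prog : List (ℕ × ℕ × ℕ)) : ℤ :=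
  ((prog.foldl slpStep [1]).getLast?).getD 1

/-- **PosSLP** (ABKM 2009, §2): "Given a straight-line program representing `N ∈ ℤ`, decide
whether `N > 0`" — as a language over `Bool`: the `encodingListNatBool`-codes of the flattened
instruction lists `[op₁, j₁, k₁, op₂, j₂, k₂, …]` of programs with positive value. Definitionally
the set whose membership in `PH` / non-membership in `P` are the route items
`Summit.PneNP.PneNP.Theses.StraightLineSign.PosSLPInPH` / `PosSLPNotInP`. [cite: AllenderEtAl2009, §2 (PosSLP)] -/
def posSLP : Language Bool :=
  encodingListNatBool.toLanguage
    {l : List ℕ | ∃ prog : List (ℕ × ℕ × ℕ),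
      l = prog.flatMap (fun ins => [ins.1, ins.2.1, ins.2.2]) ∧ 0 < slpValue prog}

/-- NAMED FACT — **PosSLP lies in the counting hierarchy** (Allender–Bürgisser–Kjeldgaard-Pedersen–
Miltersen, SIAM J. Comput. 38 (2009), Thm 1.4: "PosSLP is in `P^{PP^{PP^{PP}}}`", whence in
`CH ⊇ P^{PP^{PP^{PP}}}`; §3 "PosSLP lies in CH", Thm 3.1 (BitSLP ∈ CH, and "Theorem 3.1 shows
that BitSLP and PosSLP both lie in CH"), Thm 3.2 (`PosSLP ∈ PH^{PP^{PP}}`, with Toda's theorem).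
Vendored in the weaker CH form the tree states natively (`CH = ⋃ₖ CₖP`, majority-operator levels,
`Literature.Computability.Complexity.CH`); the route encoding of programs (`posSLP`) differs from
the printed one by a polynomial-time recoding, under which `CH` is closed
(`CH_preimage_closed`). Grounds (as context; the item is STRONGER, asking `PH`):
`Summit.PneNP.PneNP.Theses.StraightLineSign.PosSLPInPH`. [cite: AllenderEtAl2009, Thm 1.4 and §3 (Thm 3.1, Thm 3.2)] -/
def AllenderEtAl2009_posSLP_mem_CH : Prop :=
  posSLP ∈ CH

end Literature.Computability.AlgebraicComplexity
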